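import Summits.RiemannHypothesis.RiemannHypothesis.Theorems.HandoffDodgerWitnessLink
import Summits.RiemannHypothesis.RiemannHypothesis.Theorems.HandoffDodgerWitnessTransform
import Summits.RiemannHypothesis.RiemannHypothesis.Theorems.HandoffDodgerPointwiseCost
import Summits.RiemannHypothesis.RiemannHypothesis.Theorems.HandoffDodgerCostSum
import Summits.RiemannHypothesis.RiemannHypothesis.Theorems.HandoffDodgerZeroSumSymm
import Summits.RiemannHypothesis.RiemannHypothesis.Theorems.HandoffDodgerHorizonGlue
import Literature.NumberTheory.LFunctions.WeilExplicitContinuous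
import HarnessLib

/-!
# HANDOFF — the COST THEOREM of the dodger: a uniform bound for the two-sided Weil zero sum of the witness (rh-explicit, track «HANDOFF», seat prove-2 gen9, ATTEMPT-18 §3 (R-2))

HONEST FRAMING. Nothing here bears on the truth of RH; this assembles the RH-free COST side of ATTEMPT-16's THEOREM 16.2 in the kernel form of
ATTEMPT-18 (D-1)…(D-4). THE WITNESS: `b ≥ 1` with the clean-horizon hypotheses of `HandoffDodgerCleanHorizon` (`T₀ = 2πe^{1+2b}`, count bound `s ≥ 1`,
undershot horizon `T*`), a LATTICE killing height `T′ = πk′/b ≤ T*` with `K := N(T′) ≥ 1`, `T′ ≥ 2`; `F₀ := cutoffCosPoly b K (dodgerCoeff b T′ K)`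
(the dodger cut-off built on the killed multiset `zerosBetween 0 T′`), `θ := F₀ ⋆ moll n`, `G := θ(· − δ) − θ(· + δ)` (`δ ≥ 0`); generic `b`
(`hgen`: no zero-node on the lattice — `HandoffDodgerGenericWindow.exists_generic_shift` provides such `b`). THE THEOREM (`dodger_cost_le`): for EVERY `U`,

  `Σᶠ_{ρ ∈ weilZeroIndex U} m(ρ)‖Ĝ(ρ)‖² ≤ 2·[4(sinh²(δ/2)+1)·e·c_∞²·A_b·BRACKET]`,

`A_b = 4cosh²(b/2)(1+b)²/b²`, `c_∞ = Π_kℓ_k²/Π_ρ‖z_ρ‖^{2m}`, `BRACKET = N(2T′)/T′²·e^{4S_n − c/(2T′+1)²} + e^{144p²/(7c)}(N(√(c/4))/(e·c/4) + B(0,√(c/4)))`,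
`S_n = (b/π)(1+log(K−1))`, `p = 2(K−1)`, `c = 4∫_0^{T′} t·D(t)dt` (tapered deficit, assumed `≥ 64`). Ingredients: killed zeros contribute `0`
(`weilMellin_dodger_zero_of_killed`), unkilled ones are bounded by C1 × A1-link × `pointwise_cost_le`, summed by `cost_sum_le`, symmetrised by
`zeroSum_le_of_upper_le`. This is the `∀ T, Σᶠ … ≤ B` clause of `SubwindowZeroSumFamily` (p381175) for the dodger, RH-free. No `sorry`, standard
axioms, no definitions.

References: this track (ATTEMPT-16 §4 Lemma C; ATTEMPT-18 §1–§3).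
-/

set_option linter.dupNamespace false

noncomputable section

open Complex Finset MeasureTheory Real
open scoped ComplexConjugate

namespace Summit.RiemannHypothesis.RiemannHypothesis.Theorems.Handoff

open Literature.NumberTheory.LFunctions Literature.NumberTheory.LFunctions.SchoenfeldBound
  Literature.NumberTheory.LFunctions.KadiriTail Literature.NumberTheory.LFunctions.WeilContinuous

/-! ## The cut-off cosine polynomial: integrability and support -/

/-- The cut-off cosine polynomial is integrable. [folklore] -/
theorem integrable_cutoffCosPoly (b : ℝ) (K : ℕ) (a : ℕ → ℝ) : Integrable (cutoffCosPoly b K a) := by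
  unfold cutoffCosPoly
  rw [integrable_indicator_iff measurableSet_Icc]
  exact (Continuous.continuousOn (by fun_prop)).integrableOn_Icc

/-- The cut-off cosine polynomial vanishes off `[−b, b]`. [folklore] -/
theorem cutoffCosPoly_eq_zero_of_lt {b : ℝ} {K : ℕ} {a : ℕ → ℝ} {t : ℝ} (ht : b < |t|) : cutoffCosPoly b K a t = 0 := by
  unfold cutoffCosPoly
  rw [Set.indicator_of_notMem]
  intro h
  have := abs_le.2 ⟨by linarith [h.1], h.2⟩
  linarith

/-- The mollifier vanishes off `[−r, r]`, `r = rOut`. [folklore] -/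
theorem moll_eq_zero_of_lt {n : ℕ} {t : ℝ} (ht : (bump n).rOut < |t|) : moll n t = 0 := moll_eq_zero ht.le

/-! ## The transform of the witness at a zero -/

/-- **At a killed zero the witness transform vanishes** (`ρ ∈ zerosBetween 0 T′`, node off the lattice). [this track, ATTEMPT-18 (R-2)] -/
theorem weilMellin_witness_zero_of_killed {b T' δ : ℝ} (hb : 0 < b) (n : ℕ) {ρ : ℂ} (hρ : ρ ∈ zerosBetween 0 T')
    (hgen : ∀ k ∈ Finset.range (zetaZeroCount T'), dodgerNode ρ - latticeFreq b (k + 1) ≠ 0) :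
    weilMellin (fun x : ℝ =>
        weilConv (cutoffCosPoly b (zetaZeroCount T') (dodgerCoeff b T' (zetaZeroCount T'))) (moll n) (x - δ) -
        weilConv (cutoffCosPoly b (zetaZeroCount T') (dodgerCoeff b T' (zetaZeroCount T'))) (moll n) (x + δ)) ρ = 0 := by
  set F₀ := cutoffCosPoly b (zetaZeroCount T') (dodgerCoeff b T' (zetaZeroCount T')) with hF₀
  have hFi : Integrable F₀ := integrable_cutoffCosPoly b _ _
  have hFs : HasCompactSupport F₀ :=
    HasCompactSupport.of_support_subset_isCompact (isCompact_Icc (a := -b) (b := b)) fun t ht => by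
      have h : |t| ≤ b := le_of_not_gt fun h' => (Function.mem_support.1 ht) (cutoffCosPoly_eq_zero_of_lt h')
      exact Set.mem_Icc.2 (abs_le.1 h)
  have hθ : IsWeilTest (weilConv F₀ (moll n)) := isWeilTest_weilConv_of_locallyIntegrable hFi.locallyIntegrable hFs (isWeilTest_moll n)
  rw [weilMellin_translatePair hθ.1.continuous hθ.2 δ ρ,
    weilMellin_weilConv_of_expIntegrable (fun σ => integrable_mul_cexp_of_support hFi (fun t ht => cutoffCosPoly_eq_zero_of_lt ht) σ)
      (fun σ => integrable_mul_cexp_of_support ((isWeilTest_moll n).1.continuous.integrable_of_hasCompactSupport (isWeilTest_moll n).2)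
        (fun t ht => moll_eq_zero_of_lt ht) σ),
    hF₀, weilMellin_dodger_zero_of_killed hb hρ hgen]
  simp

/-- **At an unkilled zero**: `‖Ĝ(ρ)‖² ≤ 4(sinh²(δ/2)+1)·e·‖F̂₀(ρ)‖²` (C1 + the mollifier bound `‖φ̂(ρ)‖ ≤ e^{|Re ρ − ½|} ≤ e^{1/2}`).
[this track, ATTEMPT-18 (R-2)] -/
theorem normSq_weilMellin_witness_le {b T' δ : ℝ} (n : ℕ) (hδ : 0 ≤ δ) {ρ : ℂ} (h0 : 0 ≤ ρ.re) (h1 : ρ.re ≤ 1) :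
    ‖weilMellin (fun x : ℝ =>
        weilConv (cutoffCosPoly b (zetaZeroCount T') (dodgerCoeff b T' (zetaZeroCount T'))) (moll n) (x - δ) -
        weilConv (cutoffCosPoly b (zetaZeroCount T') (dodgerCoeff b T' (zetaZeroCount T'))) (moll n) (x + δ)) ρ‖ ^ 2 ≤
      4 * (Real.sinh (δ / 2) ^ 2 + 1) * Real.exp 1 *
        ‖weilMellin (cutoffCosPoly b (zetaZeroCount T') (dodgerCoeff b T' (zetaZeroCount T'))) ρ‖ ^ 2 := by
  have h := normSq_weilMellin_translatePair_le
    (integrable_cutoffCosPoly b (zetaZeroCount T') (dodgerCoeff b T' (zetaZeroCount T')))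
    (fun t ht => cutoffCosPoly_eq_zero_of_lt (K := zetaZeroCount T') (a := dodgerCoeff b T' (zetaZeroCount T')) ht)
    (isWeilTest_moll n) (fun t ht => moll_eq_zero_of_lt ht) hδ h0 h1
  refine h.trans ?_
  have hφ : ‖weilMellin (moll n) ρ‖ ^ 2 ≤ Real.exp 1 := by
    have h2 := norm_weilMellin_moll_le n ρ
    have h3 : |ρ.re - 1 / 2| ≤ 1 / 2 := abs_le.2 ⟨by linarith, by linarith⟩
    have h4 : ‖weilMellin (moll n) ρ‖ ≤ Real.exp (1 / 2) := h2.trans (Real.exp_le_exp.2 h3)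
    calc ‖weilMellin (moll n) ρ‖ ^ 2 ≤ Real.exp (1 / 2) ^ 2 := pow_le_pow_left₀ (norm_nonneg _) h4 2
      _ = Real.exp 1 := by rw [← Real.exp_nat_mul]; norm_num
  have h5 : 0 ≤ 4 * (Real.sinh (δ / 2) ^ 2 + 1) := by positivity
  calc 4 * (Real.sinh (δ / 2) ^ 2 + 1) * ‖weilMellin (moll n) ρ‖ ^ 2 *
        ‖weilMellin (cutoffCosPoly b (zetaZeroCount T') (dodgerCoeff b T' (zetaZeroCount T'))) ρ‖ ^ 2
      ≤ 4 * (Real.sinh (δ / 2) ^ 2 + 1) * Real.exp 1 *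
        ‖weilMellin (cutoffCosPoly b (zetaZeroCount T') (dodgerCoeff b T' (zetaZeroCount T'))) ρ‖ ^ 2 := by
        gcongr

/-! ## The transform of the dodger at an unkilled zero -/

/-- **Unkilled zero, pointwise.** For a zero `ρ` with `0 ≤ Re ρ ≤ 1`, `Im ρ = γ > T` (`γ ≥ 1`), a generic window (`hgen`) and a clean-horizon
deficit `D ≥ 0` on `[0, T]` (`N − Λ_K ≤ −D`, `K = N(T) ≥ 1`, `πK/b ≤ T`):
`‖F̂₀(ρ)‖² ≤ c_∞² · (4cosh²(b/2)(1+b)²/(b²γ²)) · e^{4S(γ)} · e^{−(4/(γ+1)²)∫_0^T tD}`, `S(γ) = Σ_{k<K−1} 1/(γ − ℓ_{k+1})`,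
`c_∞ = Π_kℓ_{k+1}²/Π_{ρ'}‖z_{ρ'}‖^{2m}` — the A1-link `norm_weilMellin_dodger_at_zero` times `pointwise_cost_le`. [this track, ATTEMPT-18 (D-4)/(R-2)] -/
theorem normSq_weilMellin_dodger_unkilled_le {b T : ℝ} (hb : 0 < b) (hT : 0 ≤ T) (hK1 : 1 ≤ zetaZeroCount T)
    (hK : π * (zetaZeroCount T) / b ≤ T) {D : ℝ → ℝ} (hD : ContinuousOn D (Set.Icc 0 T))
    (hD0 : ∀ t ∈ Set.Icc 0 T, 0 ≤ D t)
    (hΔ : ∀ t ∈ Set.Icc 0 T, (zetaZeroCount t : ℝ) - ((min ⌊b * t / π⌋₊ (zetaZeroCount T) : ℕ) : ℝ) ≤ -D t)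
    {ρ : ℂ} (h0 : 0 ≤ ρ.re) (h1 : ρ.re ≤ 1) (hγT : T < ρ.im) (hγ1 : 1 ≤ ρ.im)
    (hgen : ∀ k ∈ Finset.range (zetaZeroCount T), dodgerNode ρ - latticeFreq b (k + 1) ≠ 0) :
    ‖weilMellin (cutoffCosPoly b (zetaZeroCount T) (dodgerCoeff b T (zetaZeroCount T))) ρ‖ ^ 2 ≤
      ((∏ k ∈ Finset.range (zetaZeroCount T), (latticeFreq b (k + 1)) ^ 2) /
          ∏ ρ' ∈ zerosBetween 0 T, ‖dodgerNode ρ'‖ ^ (2 * (riemannZetaZeroOrder ρ').toNat)) ^ 2 *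
      (4 * Real.cosh (b / 2) ^ 2 * (1 + b) ^ 2 / (b ^ 2 * ρ.im ^ 2) *
        Real.exp (4 * ∑ k ∈ Finset.range (zetaZeroCount T - 1), 1 / (ρ.im - latticeFreq b (k + 1))) *
        Real.exp (-(4 / (ρ.im + 1) ^ 2 * ∫ t in (0 : ℝ)..T, t * D t))) := by
  have hγ0 : 0 < ρ.im := by linarith
  have hη : |(1 / 2 : ℝ) - ρ.re| ≤ 1 / 2 := abs_le.2 ⟨by linarith, by linarith⟩
  have hpc := pointwise_cost_le hb hT hK1 hK hD hD0 hΔ hη hγT hγ1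
  have dn_eq : ∀ ρ' : ℂ, ((ρ'.im : ℝ) : ℂ) + ((1 / 2 - ρ'.re : ℝ) : ℂ) * I = dodgerNode ρ' := fun _ => rfl
  have lf_eq : ∀ k : ℕ, π * ((k + 1 : ℕ) : ℝ) / b = latticeFreq b (k + 1) := fun _ => rfl
  simp only [dn_eq, lf_eq] at hpc
  have hprod : (∏ ρ' ∈ zerosBetween 0 T, ‖dodgerNode ρ ^ 2 - dodgerNode ρ' ^ 2‖ ^ riemannZetaZeroOrder ρ') =
      ∏ ρ' ∈ zerosBetween 0 T, ‖dodgerNode ρ ^ 2 - dodgerNode ρ' ^ 2‖ ^ (riemannZetaZeroOrder ρ').toNat :=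
    Finset.prod_congr rfl fun ρ' hρ' => zpow_zeroOrder_eq_pow hρ' _
  rw [hprod] at hpc
  rw [norm_weilMellin_dodger_at_zero hb hγ0 hgen, mul_pow, mul_comm]
  refine mul_le_mul_of_nonneg_left ?_ (sq_nonneg _)
  rw [mul_pow, div_pow, div_pow, mul_pow]
  exact hpc

/-! ## The cost theorem -/

/-- **COST THEOREM (R-2), RH-free.** Window half-width `b > 0`, killing height `T′ ≥ 2` with `K = N(T′) ≥ 1` and `πK/b ≤ T′`, a deficit
`D ≥ 0` continuous on `[0, T′]` with `N(t) − Λ_K(t) ≤ −D(t)` there (the clean horizon, `HandoffDodgerHorizonGlue.count_sub_latticeCount_le_neg_taper`)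
and `c := 4∫_0^{T′} tD ≥ 64`, a shift `δ ≥ 0`, a mollifier `moll n`, and a GENERIC window (`hgen`: no zero-node on the lattice —
`HandoffDodgerGenericWindow.exists_generic_shift`). Then for the witness `G = θ(· − δ) − θ(· + δ)`, `θ = F₀ ⋆ moll n`, `F₀` the dodger cut-off,
and EVERY `U`:
`Σᶠ_{ρ ∈ weilZeroIndex U} m(ρ)‖Ĝ(ρ)‖² ≤ 2·A·[N(2T′)/T′²·e^{4S_n − c/(2T′+1)²} + e^{144p²/(7c)}·(N(√(c/4))/(e·c/4) + B(0, √(c/4)))]`,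
`A = 4(sinh²(δ/2)+1)·e·c_∞²·4cosh²(b/2)(1+b)²/b²`, `S_n = (b/π)(1 + log(K−1))`, `p = 2(K−1)`. Killed zeros (`Im ρ ≤ T′`) contribute `0`
(`weilMellin_witness_zero_of_killed`); the others are bounded by `normSq_weilMellin_witness_le` × `normSq_weilMellin_dodger_unkilled_le` and summed by
`cost_sum_le`; `zeroSum_le_of_upper_le` symmetrises. This is the `∀ T, Σᶠ ≤ B` clause of a zero-sum family, for the dodger, with an explicit `B`.
[this track, ATTEMPT-16 THEOREM 16.2 cost side; ATTEMPT-18 §3] -/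
theorem dodger_cost_le {b T' δ : ℝ} (hb : 0 < b) (hT'2 : 2 ≤ T') (hK1 : 1 ≤ zetaZeroCount T')
    (hK : π * (zetaZeroCount T') / b ≤ T') {D : ℝ → ℝ} (hD : ContinuousOn D (Set.Icc 0 T'))
    (hD0 : ∀ t ∈ Set.Icc 0 T', 0 ≤ D t)
    (hΔ : ∀ t ∈ Set.Icc 0 T', (zetaZeroCount t : ℝ) - ((min ⌊b * t / π⌋₊ (zetaZeroCount T') : ℕ) : ℝ) ≤ -D t)
    (hc : 64 ≤ 4 * ∫ t in (0 : ℝ)..T', t * D t) (hδ : 0 ≤ δ) (n : ℕ)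
    (hgen : ∀ ρ : ℂ, riemannZeta ρ = 0 → 0 < ρ.im →
      ∀ k ∈ Finset.range (zetaZeroCount T'), dodgerNode ρ - latticeFreq b (k + 1) ≠ 0)
    (U : ℝ) :
    ∑ᶠ ρ ∈ weilZeroIndex U, (riemannZetaZeroOrder ρ : ℝ) *
        ‖weilMellin (fun x : ℝ =>
            weilConv (cutoffCosPoly b (zetaZeroCount T') (dodgerCoeff b T' (zetaZeroCount T'))) (moll n) (x - δ) -
            weilConv (cutoffCosPoly b (zetaZeroCount T') (dodgerCoeff b T' (zetaZeroCount T'))) (moll n) (x + δ)) ρ‖ ^ 2 ≤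
      2 * (4 * (Real.sinh (δ / 2) ^ 2 + 1) * Real.exp 1 *
            ((∏ k ∈ Finset.range (zetaZeroCount T'), (latticeFreq b (k + 1)) ^ 2) /
              ∏ ρ' ∈ zerosBetween 0 T', ‖dodgerNode ρ'‖ ^ (2 * (riemannZetaZeroOrder ρ').toNat)) ^ 2 *
            (4 * Real.cosh (b / 2) ^ 2 * (1 + b) ^ 2 / b ^ 2) *
          ((zetaZeroCount (2 * T') : ℝ) / T' ^ 2 *
              Real.exp (4 * (b / π * (1 + Real.log ((zetaZeroCount T' - 1 : ℕ) : ℝ))) -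
                (4 * ∫ t in (0 : ℝ)..T', t * D t) / (2 * T' + 1) ^ 2) +
            Real.exp (144 * (2 * ((zetaZeroCount T' - 1 : ℕ) : ℝ)) ^ 2 / (7 * (4 * ∫ t in (0 : ℝ)..T', t * D t))) *
              ((zetaZeroCount (Real.sqrt ((4 * ∫ t in (0 : ℝ)..T', t * D t) / 4)) : ℝ) /
                  (Real.exp 1 * ((4 * ∫ t in (0 : ℝ)..T', t * D t) / 4)) +
                tailBound |(0 : ℝ)| (Real.sqrt ((4 * ∫ t in (0 : ℝ)..T', t * D t) / 4))))) := by
  classical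
  have hπ := Real.pi_pos
  have hT'0 : 0 ≤ T' := by linarith
  have hI0 : 0 < ∫ t in (0 : ℝ)..T', t * D t := by linarith
  -- nonnegativity of the constants
  have hA : 0 ≤ 4 * (Real.sinh (δ / 2) ^ 2 + 1) * Real.exp 1 *
      ((∏ k ∈ Finset.range (zetaZeroCount T'), (latticeFreq b (k + 1)) ^ 2) /
        ∏ ρ' ∈ zerosBetween 0 T', ‖dodgerNode ρ'‖ ^ (2 * (riemannZetaZeroOrder ρ').toNat)) ^ 2 *
      (4 * Real.cosh (b / 2) ^ 2 * (1 + b) ^ 2 / b ^ 2) := by positivity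
  have hsqrt : 1 ≤ Real.sqrt ((4 * ∫ t in (0 : ℝ)..T', t * D t) / 4) := by
    have h := Real.sqrt_le_sqrt (show (1 : ℝ) ≤ (4 * ∫ t in (0 : ℝ)..T', t * D t) / 4 by linarith)
    rwa [Real.sqrt_one] at h
  have htb : 0 ≤ tailBound |(0 : ℝ)| (Real.sqrt ((4 * ∫ t in (0 : ℝ)..T', t * D t) / 4)) :=
    tailBound_nonneg (abs_nonneg _) hsqrt
  have hBR : 0 ≤ (zetaZeroCount (2 * T') : ℝ) / T' ^ 2 *
        Real.exp (4 * (b / π * (1 + Real.log ((zetaZeroCount T' - 1 : ℕ) : ℝ))) -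
          (4 * ∫ t in (0 : ℝ)..T', t * D t) / (2 * T' + 1) ^ 2) +
      Real.exp (144 * (2 * ((zetaZeroCount T' - 1 : ℕ) : ℝ)) ^ 2 / (7 * (4 * ∫ t in (0 : ℝ)..T', t * D t))) *
        ((zetaZeroCount (Real.sqrt ((4 * ∫ t in (0 : ℝ)..T', t * D t) / 4)) : ℝ) /
            (Real.exp 1 * ((4 * ∫ t in (0 : ℝ)..T', t * D t) / 4)) +
          tailBound |(0 : ℝ)| (Real.sqrt ((4 * ∫ t in (0 : ℝ)..T', t * D t) / 4))) :=
    add_nonneg (by positivity) (mul_nonneg (Real.exp_pos _).le (add_nonneg (by positivity) htb))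
  refine zeroSum_le_of_upper_le (fun x => im_dodgerWitness b T' n δ x) (mul_nonneg zero_le_two (mul_nonneg hA hBR))
    (fun V hV => ?_) U
  rw [mul_div_cancel_left₀ _ two_ne_zero]
  -- the killed zeros contribute nothing
  rw [← Finset.sum_filter_of_ne (p := fun ρ : ℂ => T' < ρ.im) ?kill]
  case kill =>
    intro ρ hρ hne
    refine not_le.1 fun hle => hne ?_
    obtain ⟨hz, h0, h1, him, -⟩ := mem_zerosBetween_zero hρ
    have hρT : ρ ∈ zerosBetween 0 T' := (mem_zerosBetween le_rfl).2 ⟨hz, h0, h1, him, hle⟩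
    rw [weilMellin_witness_zero_of_killed hb n hρT (hgen ρ hz him), norm_zero, zero_pow two_ne_zero, mul_zero]
  -- the lattice-gap sums `S(γ)`
  have hSn : ∀ γ : ℝ, T' < γ → γ ≤ 2 * T' →
      ∑ k ∈ Finset.range (zetaZeroCount T' - 1), 1 / (γ - latticeFreq b (k + 1)) ≤
        b / π * (1 + Real.log ((zetaZeroCount T' - 1 : ℕ) : ℝ)) := by
    intro γ h1 _
    exact sum_inv_lattice_gap_le_log hb (hK.trans h1.le)
  have hSf : ∀ γ : ℝ, 2 * T' < γ →
      ∑ k ∈ Finset.range (zetaZeroCount T' - 1), 1 / (γ - latticeFreq b (k + 1)) ≤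
        2 * ((zetaZeroCount T' - 1 : ℕ) : ℝ) / γ := by
    intro γ hγ
    have hK' : π * ((zetaZeroCount T' - 1 : ℕ) : ℝ) / b ≤ T' := by
      refine le_trans ?_ hK
      have : ((zetaZeroCount T' - 1 : ℕ) : ℝ) ≤ (zetaZeroCount T' : ℝ) := by exact_mod_cast Nat.sub_le _ 1
      exact div_le_div_of_nonneg_right (mul_le_mul_of_nonneg_left this hπ.le) hb.le
    have hγ0 : 0 < γ := by linarith
    refine (sum_inv_lattice_gap_le_div hb (by linarith)).trans ?_
    rw [mul_one_div, div_le_div_iff₀ (by linarith) hγ0]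
    nlinarith [mul_nonneg (Nat.cast_nonneg (α := ℝ) (zetaZeroCount T' - 1))
      (by linarith : (0 : ℝ) ≤ γ - 2 * (π * ((zetaZeroCount T' - 1 : ℕ) : ℝ) / b))]
  -- termwise bound, then `cost_sum_le`
  refine (Finset.sum_le_sum fun ρ hρ => ?_).trans
    (cost_sum_le (S := fun γ : ℝ => ∑ k ∈ Finset.range (zetaZeroCount T' - 1), 1 / (γ - latticeFreq b (k + 1)))
      hT'2 hc hA hSn hSf _ fun ρ hρ => ?_)
  · rw [Finset.mem_filter] at hρ
    obtain ⟨hz, h0, h1, him, -⟩ := mem_zerosBetween_zero hρ.1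
    have hlt : T' < ρ.im := hρ.2
    have hγ1 : 1 ≤ ρ.im := by linarith
    have hm0 : (0 : ℝ) ≤ riemannZetaZeroOrder ρ := zeroOrder_nonneg_of_mem_zerosBetween le_rfl hρ.1
    have hG := normSq_weilMellin_witness_le (b := b) (T' := T') n hδ h0 h1 (ρ := ρ)
    have hF := normSq_weilMellin_dodger_unkilled_le hb hT'0 hK1 hK hD hD0 hΔ h0 h1 hlt hγ1 (hgen ρ hz him)
    refine mul_le_mul_of_nonneg_left (hG.trans ?_) hm0
    have h4 : 0 ≤ 4 * (Real.sinh (δ / 2) ^ 2 + 1) * Real.exp 1 := by positivity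
    refine (mul_le_mul_of_nonneg_left hF h4).trans (le_of_eq ?_)
    have hE : Real.exp (-(4 / (ρ.im + 1) ^ 2 * ∫ t in (0 : ℝ)..T', t * D t)) =
        Real.exp (-(4 * ∫ t in (0 : ℝ)..T', t * D t) / (ρ.im + 1) ^ 2) := by
      congr 1; ring
    rw [hE]
    ring
  · rw [Finset.mem_filter] at hρ
    obtain ⟨hz, h0, h1, -, -⟩ := mem_zerosBetween_zero hρ.1
    exact ⟨hz, h0, h1, hρ.2⟩

end Summit.RiemannHypothesis.RiemannHypothesis.Theorems.Handoff

end
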